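import Summits.AtomisticToContinuum.FouriersLaw.Theorems.BondHeatUncertaintyExtensiveSnapshotIrreversibilityEnergyWindowSkeletonDepartureIntegrability
import Summits.AtomisticToContinuum.FouriersLaw.Theorems.BondHeatUncertaintyExtensiveSnapshotIrreversibilityEnergyWindowArrivalGlue

/-!
# Energy window, part W-6 — the DEPARTURE GLUE:
(SWM)_d → (JM)✓ → (JMˣ)₁✓ → (JMˣ)₂✓ → (I-s2)ₛ → (G1ℓ) `EqualTemperatureBathLipschitz`

Lineage `stmt-AtomisticToContinuum-9121` (`ExtensiveSnapshotIrreversibility`), K_fix half, leaf S3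
`KernelTemperatureLipschitz ⟸ (Dˢ) ∧ (G1ℓ) ∧ (G1*ᶜᶜ)` (Rᵇ); cell decomp-a2c, lens «grading /
quantitative ladder», generation 81, part W «Glues», file 6 (the V-glue; the U-glue is W-3).

THEOREM (`equalTemperatureBathLipschitz_of_skeleton`).  `SkeletonWeightMoments` (SWM, S4 — its
DEPARTURE clause) and `SkeletonEventualSurjectivity` ((I-s2)ₛ, W-0) imply
`EqualTemperatureBathLipschitz` ((G1ℓ), Rᵇ): for `h ∈ C_c^∞`, `|h| ≤ e^{θH}`, `0 < θ < θ₁ < 1/T`,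
a bath momentum `b` and `0 < r ≤ 1`,
`|P⁰_r h(q, p[b ↦ t]) − P⁰_r h(q, p)| ≤ C r^{-b₀} |t − p_b| max(e^{θ₁H(q,p)}, e^{θ₁H(q,p[b↦t])})`.

PROOF.  (§1) `(q, p[b ↦ t]) = w + c(0, e_b)`, `c = t − p_b`, and along the momentum segment
`z_τ = w + τc(0,e_b)` the energy is `H(w) + p_bτc + τ²c²/2 ≤ max(H(z₀), H(z₁))` (convexity).
(§2) Pathwise, `τ ↦ h(X_r(z_τ, B))` is `C¹` (R `contDiff_skelFlowMapAt_left`, a GENUINE derivative)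
with derivative `c ∂_{p_b}(h ∘ X_r(·, B))(z_τ)`, so `h(X_r(z₁)) − h(X_r(z₀)) = c∫₀¹ ∂_{p_b}(h∘X_r)(z_τ)dτ`
(FTC).  (§5) Fubini — legitimate because `|∂_{p_b}(h∘X_r)(z)| ≤ L‖∂_zX_r(z)[(0,e_b)]‖` and the
first moment of the starting-point variation is `≤ C e^{H(z)}` (W-5 `skeletonStartVariationMoments`,
the (JM) `FlowJacobianMoment` mechanism — tree theorem `flowJacobianMoment`), uniformly on the
segment by §1 — gives `P⁰_rh(z₁) − P⁰_rh(z₀) = c ∫₀¹ G(z_τ) dτ`, `G(z) = E[∂_{p_b}(h∘X_r(·,B))(z)]`.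
(§3–4) For each `z`: the DEPARTURE identity of T-b (`integral_mul_skelWeightDep_eq`, level `m`,
`κ > 0`; its four `L¹` conditions are W-5's theorems, from (JMˣ)₁ `skeletonJacobianMoments`, (JMˣ)₂
`skeletonSecondVariationMoments` (V-c, GENUINE second derivatives via V-b2
`norm_fderiv_fderiv_skelFlowMapAt_le` / V-a `contDiff_forcedSolution_family`), the mixed variation
W-4 and (JMᶻ)) rewrites `G(z) = E[h(E_m)W^dep_{m,κ}] + κE[Dh(E_m)·(Γ_m+κ)⁻¹V]`; Hölder with
`p = 2/(1+θT)` (so `pθ < 1/T`, CEHR (3.4): `‖h(E_m)‖_p ≤ e^{2θγT/p}e^{θH(z)}`, W-3) and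
`q = 2/(1−θT) ≥ 2` ((SWM)_d with `ε = θ₁−θ`: `‖W^dep‖_q ≤ |C|r^{-b₀}e^{(θ₁−θ)H(z)}` for `m ≥ m₁(κ)`)
bounds the first term; the second is `≤ L E√D_n → 0` along `κ_n = 1/(n+1)`, `m ≥ n` (W-0
`exists_lintegral_sqrt_defectSq_le`, with the RANDOM direction `V = coordV ∂_zX_r[(0,e_b)]`, whose
first moment is finite by (JMᶻ) — this is where (I-s2)ₛ enters).  Hence `|G(z)| ≤ C'r^{-b₀}e^{θ₁H(z)}`
and the theorem follows with `a = b₀ < 1`.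
§7 records the junctions: the arrival glue (W-3) with (JMˣ)₂ discharged by V-c, S3
`KernelTemperatureLipschitz ⟸ (Dˢ) ∧ (SWM) ∧ (I-s2)ₛ`, and `K_fix ⟸ A0 ∧ A2 ∧ (Dˢ) ∧ (SWM) ∧
(I-s2)ₛ ∧ A3p ∧ A4` (Rᵇ `snapshotKLUpperExpansion_of_atoms₇R`).
No (SWM)-type claim is made (critic row 1093 (g)): (SWM) is the HYPOTHESIS `hW`.
References: Cuneo–Eckmann–Hairer–Rey-Bellet, Electron. J. Probab. 23 (2018) §3 eq. (3.4)
[cite: CuneoEckmannHairerReyBellet2018, §3 eq. (3.4)]; D. Nualart, The Malliavin Calculus and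
Related Topics (2006), Prop. 1.3.1, §2.1.4 [cite: Nualart2006, Prop 1.3.1]. [folklore]

**File 1 of 3** (split for the 400-line cap): this file holds §§1–3 (momentum segment, pathwise FTC, the departure defect term); the sequel modules `…BondHeatUncertaintyExtensiveSnapshotIrreversibilityEnergyWindowDepartureGlueB`, `…BondHeatUncertaintyExtensiveSnapshotIrreversibilityEnergyWindowDepartureGlue` continue in the same namespace (all declaration names unchanged).
-/

noncomputable section

namespace Summit.AtomisticToContinuum.FouriersLaw.Theorems.ExtensiveSnapshotIrreversibility.EnergyWindow

open MeasureTheory ProbabilityTheory Filter Topology Set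
open scoped ENNReal NNReal Matrix ContDiff
open Literature.MathematicalPhysics.KineticTheory.HeatConduction
open Literature.Probability.Process
open Literature.Probability.Distributions

/-! ## 1. The momentum segment -/

/-- `(q, p[b ↦ t]) = (q, p) + (t − p_b)·(0, e_b)`. [folklore] -/
theorem prod_update_eq_add_smul {N : ℕ} (w : PhaseSpace N) (b : Fin N) (t : ℝ) :
    ((w.1, Function.update w.2 b t) : PhaseSpace N) =
      w + (t - w.2 b) • (((0 : Fin N → ℝ), Pi.single b 1) : PhaseSpace N) := by
  refine Prod.ext ?_ ?_
  · rw [add_smul_unitP_fst]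
  · rw [add_smul_unitP_snd, add_smul_single_eq_update, add_sub_cancel]

/-- `H(x + t(0,e_b)) = H(x) + (p_b t + t²/2)`. [folklore] -/
theorem hamiltonian_add_smul_unitP (P : OscillatorChain) {N : ℕ} (x : PhaseSpace N) (b : Fin N)
    (t : ℝ) :
    P.hamiltonian N (x + t • (((0 : Fin N → ℝ), Pi.single b 1) : PhaseSpace N)) =
      P.hamiltonian N x + (x.2 b * t + t ^ 2 / 2) := by
  rw [P.hamiltonian_eq_kinetic_add_potential, P.hamiltonian_eq_kinetic_add_potential,
    add_smul_unitP_fst, add_smul_unitP_snd, add_smul_single_eq_update]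
  have h : ∑ i, Function.update x.2 b (x.2 b + t) i ^ 2 / 2 =
      (∑ i, x.2 i ^ 2 / 2) + (x.2 b * t + t ^ 2 / 2) := by
    rw [← Finset.add_sum_erase _ _ (Finset.mem_univ b),
      ← Finset.add_sum_erase _ (fun i => x.2 i ^ 2 / 2) (Finset.mem_univ b), Function.update_self]
    rw [Finset.sum_congr rfl fun k hk => by rw [Function.update_of_ne (Finset.ne_of_mem_erase hk)]]
    ring
  rw [h]
  ring

/-- **Energy along the momentum segment** `z_τ = x + τc(0,e_b)`, `τ ∈ [0,1]`:
`H(z_τ) ≤ max(H(z_0), H(z_1))` (convexity of `τ ↦ (p_b + τc)²`). [folklore] -/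
theorem hamiltonian_segment_le_max (P : OscillatorChain) {N : ℕ} (x : PhaseSpace N) (b : Fin N)
    (c : ℝ) {τ : ℝ} (hτ : τ ∈ Icc (0 : ℝ) 1) :
    P.hamiltonian N (x + (τ * c) • (((0 : Fin N → ℝ), Pi.single b 1) : PhaseSpace N)) ≤
      max (P.hamiltonian N x)
        (P.hamiltonian N (x + c • (((0 : Fin N → ℝ), Pi.single b 1) : PhaseSpace N))) := by
  rw [hamiltonian_add_smul_unitP, hamiltonian_add_smul_unitP]
  have hprod : 0 ≤ τ * (1 - τ) * c ^ 2 :=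
    mul_nonneg (mul_nonneg hτ.1 (sub_nonneg.2 hτ.2)) (sq_nonneg c)
  have key : x.2 b * (τ * c) + (τ * c) ^ 2 / 2 ≤ τ * (x.2 b * c + c ^ 2 / 2) := by
    nlinarith [hprod]
  rcases le_or_gt 0 (x.2 b * c + c ^ 2 / 2) with h | h
  · exact le_max_of_le_right (by linarith [mul_le_of_le_one_left h hτ.2])
  · exact le_max_of_le_left (by nlinarith [mul_nonpos_of_nonneg_of_nonpos hτ.1 h.le])

/-! ## 2. Chain rule in the starting point; the pathwise FTC along the segment -/

section Path

variable {ω₂ lam β γ : ℝ} (hω : 0 < ω₂) (hl : 0 ≤ lam) (hβ : 0 ≤ β) (hγ : 0 ≤ γ) (N : ℕ)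
  (T_L T_R : ℝ)

include hω hl hβ hγ

/-- Chain rule in the starting point: `∂_z(g ∘ E)(z)[v] = Dg(E) ∂_zE[v]`. [folklore] -/
theorem fderiv_comp_skelFlowMapAt_left_apply {s : ℝ} (hs : s ∈ Icc (0 : ℝ) 1) (m : ℕ)
    (z : PhaseSpace N) (r : WienerPair) (x : PairSkeleton m) {g : PhaseSpace N → ℝ}
    (hg : DifferentiableAt ℝ g (skelFlowMapAt ω₂ lam β γ N T_L T_R s m z r x)) (v : PhaseSpace N) :
    fderiv ℝ (fun z' => g (skelFlowMapAt ω₂ lam β γ N T_L T_R s m z' r x)) z v =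
      fderiv ℝ g (skelFlowMapAt ω₂ lam β γ N T_L T_R s m z r x)
        (fderiv ℝ (fun z' => skelFlowMapAt ω₂ lam β γ N T_L T_R s m z' r x) z v) := by
  have hE : DifferentiableAt ℝ (fun z' => skelFlowMapAt ω₂ lam β γ N T_L T_R s m z' r x) z :=
    (contDiff_skelFlowMapAt_left hω hl hβ hγ N T_L T_R hs m r x).differentiable (by simp) z
  rw [show (fun z' => g (skelFlowMapAt ω₂ lam β γ N T_L T_R s m z' r x)) =
      g ∘ (fun z' => skelFlowMapAt ω₂ lam β γ N T_L T_R s m z' r x) from rfl, fderiv_comp z hg hE]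
  rfl

/-- `∂_{p_b}(g ∘ E(·, r, x))(z) = Dg(E) ∂_zE[(0, e_b)]` for `g ∈ C¹`. [folklore] -/
theorem partialP_comp_skelFlowMapAt_eq {s : ℝ} (hs : s ∈ Icc (0 : ℝ) 1) (m : ℕ) (b : Fin N)
    (z : PhaseSpace N) (r : WienerPair) (x : PairSkeleton m) {g : PhaseSpace N → ℝ}
    (hg : ContDiff ℝ 1 g) :
    partialP b (fun z' => g (skelFlowMapAt ω₂ lam β γ N T_L T_R s m z' r x)) z =
      fderiv ℝ g (skelFlowMapAt ω₂ lam β γ N T_L T_R s m z r x)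
        (fderiv ℝ (fun z' => skelFlowMapAt ω₂ lam β γ N T_L T_R s m z' r x) z
          ((0 : Fin N → ℝ), Pi.single b 1)) := by
  have hE := contDiff_skelFlowMapAt_left hω hl hβ hγ N T_L T_R hs m r x
  have hd : DifferentiableAt ℝ (fun z' => g (skelFlowMapAt ω₂ lam β γ N T_L T_R s m z' r x)) z :=
    ((hg.differentiable one_ne_zero) _).comp z (hE.differentiable (by simp) z)
  rw [partialP_eq_fderiv_apply b hd, fderiv_comp_skelFlowMapAt_left_apply hω hl hβ hγ N T_L T_R hs
    m z r x ((hg.differentiable one_ne_zero) _)]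

/-- **Pathwise FTC along the momentum segment**: for `g ∈ C¹`, `v₀ = (0, e_b)`,
`g(E(z + c v₀)) − g(E(z)) = ∫₀¹ c ∂_{p_b}(g ∘ E)(z + τc v₀) dτ` (R `contDiff_skelFlowMapAt_left`).
[folklore] -/
theorem comp_skelFlowMapAt_add_smul_sub_eq {s : ℝ} (hs : s ∈ Icc (0 : ℝ) 1) (m : ℕ) (b : Fin N)
    (z : PhaseSpace N) (c : ℝ) (r : WienerPair) (x : PairSkeleton m) {g : PhaseSpace N → ℝ}
    (hg : ContDiff ℝ 1 g) :
    g (skelFlowMapAt ω₂ lam β γ N T_L T_R s m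
        (z + c • (((0 : Fin N → ℝ), Pi.single b 1) : PhaseSpace N)) r x) -
        g (skelFlowMapAt ω₂ lam β γ N T_L T_R s m z r x) =
      ∫ τ in (0 : ℝ)..1, c * partialP b (fun z' => g (skelFlowMapAt ω₂ lam β γ N T_L T_R s m z' r x))
        (z + (τ * c) • (((0 : Fin N → ℝ), Pi.single b 1) : PhaseSpace N)) := by
  set v₀ : PhaseSpace N := ((0 : Fin N → ℝ), Pi.single b 1) with hv₀
  set Φ : PhaseSpace N → ℝ := fun z' => g (skelFlowMapAt ω₂ lam β γ N T_L T_R s m z' r x) with hΦ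
  have hE := contDiff_skelFlowMapAt_left hω hl hβ hγ N T_L T_R hs m r x
  have hΦd : Differentiable ℝ Φ := fun z' =>
    ((hg.differentiable one_ne_zero) _).comp z' (hE.differentiable (by simp) z')
  have hΦc : Continuous fun w => fderiv ℝ Φ w := by
    have h1 : ContDiff ℝ 1 Φ := hg.comp (hE.of_le (by exact_mod_cast le_top))
    exact h1.continuous_fderiv one_ne_zero
  have hpath : ∀ τ : ℝ, HasDerivAt (fun τ : ℝ => z + (τ * c) • v₀) (c • v₀) τ := fun τ =>
    ((hasDerivAt_mul_const c).smul_const v₀).const_add z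
  have hder : ∀ τ : ℝ, HasDerivAt (fun τ : ℝ => Φ (z + (τ * c) • v₀))
      (fderiv ℝ Φ (z + (τ * c) • v₀) (c • v₀)) τ := fun τ =>
    (hΦd _).hasFDerivAt.comp_hasDerivAt τ (hpath τ)
  have hcont : Continuous fun τ : ℝ => fderiv ℝ Φ (z + (τ * c) • v₀) (c • v₀) :=
    (hΦc.comp (continuous_const.add ((continuous_id.mul continuous_const).smul
      continuous_const))).clm_apply continuous_const
  have hftc := intervalIntegral.integral_eq_sub_of_hasDerivAt (fun τ _ => hder τ)
    (hcont.intervalIntegrable 0 1)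
  simp only [one_mul, zero_mul, zero_smul, add_zero] at hftc
  rw [show g (skelFlowMapAt ω₂ lam β γ N T_L T_R s m (z + c • v₀) r x) -
      g (skelFlowMapAt ω₂ lam β γ N T_L T_R s m z r x) = Φ (z + c • v₀) - Φ z from rfl, ← hftc]
  refine intervalIntegral.integral_congr fun τ _ => ?_
  show fderiv ℝ Φ (z + (τ * c) • v₀) (c • v₀) = c * partialP b Φ (z + (τ * c) • v₀)
  rw [map_smul, smul_eq_mul, partialP_eq_fderiv_apply b (hΦd _)]

end Path

/-! ## 3. The departure defect term (random direction `V`) -/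

/-- The **level-free departure vector along the path**, read at level `0`:
`V(B) = coordV(∂_z X_s(z, B)[(0, e_b)])` (`skelDepVec_level_eq`). [folklore] -/
def depVecPath (ω₂ lam β γ : ℝ) (N : ℕ) (T_L T_R s : ℝ) (b : Fin N) (z : PhaseSpace N)
    (wp : WienerPair) : Fin N ⊕ Fin N → ℝ :=
  skelDepVec ω₂ lam β γ N T_L T_R s 0 b z (pairRem 0 wp) (pairSkel 0 wp)

section Departure

variable {ω₂ lam β γ : ℝ} (hω : 0 < ω₂) (hl : 0 < lam) (hβ : 0 < β) (hγ : 0 < γ) {N : ℕ}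
  (hN : 0 < N) {T T_L T_R : ℝ} (hT : 0 < T) (hTL : T / 2 ≤ T_L) (hTL' : T_L ≤ 2 * T)
  (hTR : T / 2 ≤ T_R) (hTR' : T_R ≤ 2 * T)

include hω hl hβ hγ in
/-- The departure vector at level `m` along the path is `V`. [folklore] -/
theorem skelDepVec_path_eq_depVecPath {s : ℝ} (hs : s ∈ Icc (0 : ℝ) 1) (m : ℕ) (b : Fin N)
    (z : PhaseSpace N) (wp : WienerPair) :
    skelDepVec ω₂ lam β γ N T_L T_R s m b z (pairRem m wp) (pairSkel m wp) =
      depVecPath ω₂ lam β γ N T_L T_R s b z wp :=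
  skelDepVec_level_eq hω hl.le hβ.le hγ.le N T_L T_R hs m 0 b z wp

include hω hl hβ hγ in
/-- The departure control along the path is `(Γ_m + κ)⁻¹ V` (S′ `skelCtrlDep_path_eq`). [folklore] -/
theorem skelCtrlDep_path_eq_depVecPath {s : ℝ} (hs : s ∈ Icc (0 : ℝ) 1) (m : ℕ) (κ : ℝ)
    (b : Fin N) (z : PhaseSpace N) (wp : WienerPair) :
    skelCtrlDep ω₂ lam β γ N T_L T_R s m κ b z (pairRem m wp) (pairSkel m wp) =
      regInv (skelGramPath ω₂ lam β γ N T_L T_R s m z wp) κ *ᵥ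
        depVecPath ω₂ lam β γ N T_L T_R s b z wp := by
  rw [skelCtrlDep_path_eq N T_L T_R s m κ b z wp, skelDepVec_path_eq_depVecPath hω hl hβ hγ hs m b z wp]

include hω hl hβ hγ in
/-- The coordinates of `V` are measurable. [folklore] -/
theorem measurable_depVecPath_apply {s : ℝ} (hs : s ∈ Icc (0 : ℝ) 1) (b : Fin N) (z : PhaseSpace N)
    (a : Fin N ⊕ Fin N) :
    Measurable fun wp : WienerPair => depVecPath ω₂ lam β γ N T_L T_R s b z wp a := by
  have h := (measurable_skelDepVec_apply hω hl.le hβ.le hγ.le N T_L T_R hs 0 b z a).comp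
    (measurable_pairSkel_prodMk_pairRem 0)
  exact h

omit hl hβ hγ hω in
/-- `Σ_a |V_a| ≤ 2N ‖∂_z E_0[(0,e_b)]‖`. [folklore] -/
theorem sum_abs_depVecPath_le (s : ℝ) (b : Fin N) (z : PhaseSpace N) (wp : WienerPair) :
    ∑ a, |depVecPath ω₂ lam β γ N T_L T_R s b z wp a| ≤
      (Fintype.card (Fin N ⊕ Fin N) : ℝ) *
        ‖fderiv ℝ (fun z' => skelFlowMapAt ω₂ lam β γ N T_L T_R s 0 z' (pairRem 0 wp) (pairSkel 0 wp))
          z ((0 : Fin N → ℝ), Pi.single b 1)‖ :=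
  sum_abs_skelDepVec_le N T_L T_R s 0 b z (pairRem 0 wp) (pairSkel 0 wp)

include hω hl hβ hγ hN hT hTL hTL' hTR hTR' in
/-- **`Σ_a |V_a| ∈ L¹`** (first moment of the starting-point variation, (JMᶻ)/(JM)). [folklore] -/
theorem integrable_sum_abs_depVecPath {s : ℝ} (hs : s ∈ Icc (0 : ℝ) 1) (b : Fin N)
    (z : PhaseSpace N) :
    Integrable (fun wp : WienerPair => ∑ a, |depVecPath ω₂ lam β γ N T_L T_R s b z wp a|)
      wienerPair := by
  have hZ1 := integrable_pow_norm_fderiv_left_path hω hl hβ hγ hN hT hTL hTL' hTR hTR' hs 0 z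
    ((0 : Fin N → ℝ), Pi.single b 1) 1 le_rfl
  refine Integrable.mono' (hZ1.const_mul ((Fintype.card (Fin N ⊕ Fin N) : ℝ)))
    (Finset.measurable_sum Finset.univ fun a _ => continuous_abs.measurable.comp
      (measurable_depVecPath_apply hω hl hβ hγ hs b z a)).aestronglyMeasurable
    (Eventually.of_forall fun wp => ?_)
  rw [Real.norm_eq_abs, abs_of_nonneg (Finset.sum_nonneg fun a _ => abs_nonneg _), pow_one]
  exact sum_abs_depVecPath_le s b z wp

include hω hl hβ hγ hN hT hTL hTL' hTR hTR' in
/-- `E √(V·V) < ∞`. [folklore] -/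
theorem lintegral_sqrt_dotProduct_depVecPath_ne_top {s : ℝ} (hs : s ∈ Icc (0 : ℝ) 1) (b : Fin N)
    (z : PhaseSpace N) :
    ∫⁻ wp, ENNReal.ofReal (√(depVecPath ω₂ lam β γ N T_L T_R s b z wp ⬝ᵥ
        depVecPath ω₂ lam β γ N T_L T_R s b z wp)) ∂wienerPair ≠ ⊤ := by
  have hI := integrable_sum_abs_depVecPath hω hl hβ hγ hN hT hTL hTL' hTR hTR' hs b z
  have hfin := ((hasFiniteIntegral_iff_ofReal (ae_of_all _ fun wp =>
    Finset.sum_nonneg fun a _ => abs_nonneg _)).1 hI.hasFiniteIntegral).ne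
  exact ne_top_of_le_ne_top hfin (lintegral_mono fun wp =>
    ENNReal.ofReal_le_ofReal (sqrt_dotProduct_le_sum_abs _))

include hω hl hβ hγ in
/-- **Pointwise size of the departure defect term** (level `m ≥ n`, `κ_n = 1/(n+1)`):
`|κ_n Dg(E) (Γ_m+κ_n)⁻¹V| ≤ L √D_n` (W-0 `mul_norm_ofCoordV_regInv_le_sqrt_defectSq`). [folklore] -/
theorem norm_depDefectTerm_le {s : ℝ} (hs : s ∈ Icc (0 : ℝ) 1) (z : PhaseSpace N) (b : Fin N)
    {g : PhaseSpace N → ℝ} {L : ℝ} (hL : 0 ≤ L) (hgL : ∀ w v, |fderiv ℝ g w v| ≤ L * ‖v‖)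
    {n m : ℕ} (hnm : n ≤ m) (wp : WienerPair) :
    ‖((n : ℝ) + 1)⁻¹ * fderiv ℝ g (skelFlowMapAt ω₂ lam β γ N T_L T_R s m z (pairRem m wp)
        (pairSkel m wp)) (ofCoordV N (skelCtrlDep ω₂ lam β γ N T_L T_R s m ((n : ℝ) + 1)⁻¹ b z
          (pairRem m wp) (pairSkel m wp)))‖ ≤
      L * √(defectSq ω₂ lam β γ N T_L T_R s z (depVecPath ω₂ lam β γ N T_L T_R s b z) n wp) := by
  rw [skelCtrlDep_path_eq_depVecPath hω hl hβ hγ hs m _ b z wp, Real.norm_eq_abs, abs_mul,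
    abs_of_pos (inv_natCast_succ_pos n)]
  have h1 := hgL (skelFlowMapAt ω₂ lam β γ N T_L T_R s m z (pairRem m wp) (pairSkel m wp))
    (ofCoordV N (regInv (skelGramPath ω₂ lam β γ N T_L T_R s m z wp) ((n : ℝ) + 1)⁻¹ *ᵥ
      depVecPath ω₂ lam β γ N T_L T_R s b z wp))
  have h2 : ((n : ℝ) + 1)⁻¹ * ‖ofCoordV N (regInv (skelGramPath ω₂ lam β γ N T_L T_R s m z wp)
      ((n : ℝ) + 1)⁻¹ *ᵥ depVecPath ω₂ lam β γ N T_L T_R s b z wp)‖ ≤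
      √(defectSq ω₂ lam β γ N T_L T_R s z (depVecPath ω₂ lam β γ N T_L T_R s b z) n wp) :=
    mul_norm_ofCoordV_regInv_le_sqrt_defectSq hω hl.le hβ.le hγ.le N T_L T_R hs z
      (depVecPath ω₂ lam β γ N T_L T_R s b z) hnm wp
  calc ((n : ℝ) + 1)⁻¹ * |fderiv ℝ g (skelFlowMapAt ω₂ lam β γ N T_L T_R s m z (pairRem m wp)
        (pairSkel m wp)) (ofCoordV N (regInv (skelGramPath ω₂ lam β γ N T_L T_R s m z wp)
          ((n : ℝ) + 1)⁻¹ *ᵥ depVecPath ω₂ lam β γ N T_L T_R s b z wp))|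
      ≤ ((n : ℝ) + 1)⁻¹ * (L * ‖ofCoordV N (regInv (skelGramPath ω₂ lam β γ N T_L T_R s m z wp)
          ((n : ℝ) + 1)⁻¹ *ᵥ depVecPath ω₂ lam β γ N T_L T_R s b z wp)‖) :=
        mul_le_mul_of_nonneg_left h1 (inv_natCast_succ_pos n).le
    _ = L * (((n : ℝ) + 1)⁻¹ * ‖ofCoordV N (regInv (skelGramPath ω₂ lam β γ N T_L T_R s m z wp)
          ((n : ℝ) + 1)⁻¹ *ᵥ depVecPath ω₂ lam β γ N T_L T_R s b z wp)‖) := by ring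
    _ ≤ _ := mul_le_mul_of_nonneg_left h2 hL

include hω hl hβ hγ in
/-- The departure defect term is measurable along the path (`g ∈ C¹`). [folklore] -/
theorem measurable_depDefectTerm {s : ℝ} (hs : s ∈ Icc (0 : ℝ) 1) (m : ℕ) (κ : ℝ) (b : Fin N)
    (z : PhaseSpace N) {g : PhaseSpace N → ℝ} (hg : ContDiff ℝ 1 g) :
    Measurable fun wp : WienerPair => κ * fderiv ℝ g (skelFlowMapAt ω₂ lam β γ N T_L T_R s m z
      (pairRem m wp) (pairSkel m wp)) (ofCoordV N (skelCtrlDep ω₂ lam β γ N T_L T_R s m κ b z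
        (pairRem m wp) (pairSkel m wp))) := by
  have hc : ∀ a, Measurable fun wp : WienerPair =>
      skelCtrlDep ω₂ lam β γ N T_L T_R s m κ b z (pairRem m wp) (pairSkel m wp) a := fun a => by
    have h := (measurable_skelCtrlDep_apply hω hl.le hβ.le hγ.le N T_L T_R hs m κ b z a).comp
      (measurable_pairSkel_prodMk_pairRem m)
    exact h
  have hv : Measurable fun wp : WienerPair =>
      ofCoordV N (skelCtrlDep ω₂ lam β γ N T_L T_R s m κ b z (pairRem m wp) (pairSkel m wp)) :=
    (measurable_pi_lambda _ fun i => hc (Sum.inl i)).prodMk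
      (measurable_pi_lambda _ fun i => hc (Sum.inr i))
  have hE : Measurable fun wp : WienerPair =>
      skelFlowMapAt ω₂ lam β γ N T_L T_R s m z (pairRem m wp) (pairSkel m wp) := by
    have h := (measurable_skelFlowMapAt hω hl.le hβ.le hγ.le N T_L T_R s m z).comp
      (measurable_pairSkel_prodMk_pairRem m)
    exact h
  have hcont : Continuous fun p : PhaseSpace N × PhaseSpace N => fderiv ℝ g p.1 p.2 :=
    ((hg.continuous_fderiv one_ne_zero).comp continuous_fst).clm_apply continuous_snd
  have h := (hcont.measurable.comp (hE.prodMk hv)).const_mul κ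
  exact h

include hω hl hβ hγ hN hT hTL hTL' hTR hTR' in
/-- The departure defect term is integrable (bounded by `L Σ_a|V_a| ∈ L¹`). [folklore] -/
theorem integrable_depDefectTerm {s : ℝ} (hs : s ∈ Icc (0 : ℝ) 1) (z : PhaseSpace N) (b : Fin N)
    {g : PhaseSpace N → ℝ} (hg : ContDiff ℝ 1 g) {L : ℝ} (hL : 0 ≤ L)
    (hgL : ∀ w v, |fderiv ℝ g w v| ≤ L * ‖v‖) {n m : ℕ} (hnm : n ≤ m) :
    Integrable (fun wp : WienerPair => ((n : ℝ) + 1)⁻¹ * fderiv ℝ g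
      (skelFlowMapAt ω₂ lam β γ N T_L T_R s m z (pairRem m wp) (pairSkel m wp))
        (ofCoordV N (skelCtrlDep ω₂ lam β γ N T_L T_R s m ((n : ℝ) + 1)⁻¹ b z (pairRem m wp)
          (pairSkel m wp)))) wienerPair :=
  Integrable.mono' ((integrable_sum_abs_depVecPath hω hl hβ hγ hN hT hTL hTL' hTR hTR' hs b
      z).const_mul L)
    (measurable_depDefectTerm hω hl hβ hγ hs m _ b z hg).aestronglyMeasurable
    (Eventually.of_forall fun wp =>
      (norm_depDefectTerm_le hω hl hβ hγ hs z b hL hgL hnm wp).trans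
        (mul_le_mul_of_nonneg_left ((Real.sqrt_le_sqrt
          (defectSq_le_dotProduct N T_L T_R s z (depVecPath ω₂ lam β γ N T_L T_R s b z) n wp)).trans
            (sqrt_dotProduct_le_sum_abs _)) hL))

include hω hl hβ hγ in
/-- **The departure defect integral is `≤ L η`** once `E√D_n ≤ η` (level `m ≥ n`). [folklore] -/
theorem abs_integral_depDefectTerm_le {s : ℝ} (hs : s ∈ Icc (0 : ℝ) 1) (m : ℕ) (z : PhaseSpace N)
    (b : Fin N) {g : PhaseSpace N → ℝ} {L : ℝ} (hL : 0 ≤ L)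
    (hgL : ∀ w v, |fderiv ℝ g w v| ≤ L * ‖v‖) {n : ℕ} (hnm : n ≤ m) {η : ℝ} (hη : 0 ≤ η)
    (hD : ∫⁻ wp, ENNReal.ofReal
        (√(defectSq ω₂ lam β γ N T_L T_R s z (depVecPath ω₂ lam β γ N T_L T_R s b z) n wp))
          ∂wienerPair ≤ ENNReal.ofReal η) :
    |∫ wp, ((n : ℝ) + 1)⁻¹ * fderiv ℝ g (skelFlowMapAt ω₂ lam β γ N T_L T_R s m z (pairRem m wp)
        (pairSkel m wp)) (ofCoordV N (skelCtrlDep ω₂ lam β γ N T_L T_R s m ((n : ℝ) + 1)⁻¹ b z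
          (pairRem m wp) (pairSkel m wp))) ∂wienerPair| ≤ L * η := by
  have hint : ∫⁻ wp, ENNReal.ofReal ‖((n : ℝ) + 1)⁻¹ * fderiv ℝ g
      (skelFlowMapAt ω₂ lam β γ N T_L T_R s m z (pairRem m wp) (pairSkel m wp))
        (ofCoordV N (skelCtrlDep ω₂ lam β γ N T_L T_R s m ((n : ℝ) + 1)⁻¹ b z (pairRem m wp)
          (pairSkel m wp)))‖ ∂wienerPair ≤ ENNReal.ofReal L * ENNReal.ofReal η := by
    calc _ ≤ ∫⁻ wp, ENNReal.ofReal (L *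
          √(defectSq ω₂ lam β γ N T_L T_R s z (depVecPath ω₂ lam β γ N T_L T_R s b z) n wp))
            ∂wienerPair :=
          lintegral_mono fun wp => ENNReal.ofReal_le_ofReal
            (norm_depDefectTerm_le hω hl hβ hγ hs z b hL hgL hnm wp)
      _ = ENNReal.ofReal L * ∫⁻ wp, ENNReal.ofReal
          (√(defectSq ω₂ lam β γ N T_L T_R s z (depVecPath ω₂ lam β γ N T_L T_R s b z) n wp))
            ∂wienerPair := by
          rw [← lintegral_const_mul' _ _ ENNReal.ofReal_ne_top]
          refine lintegral_congr fun wp => ?_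
          rw [ENNReal.ofReal_mul hL]
      _ ≤ ENNReal.ofReal L * ENNReal.ofReal η := mul_le_mul_right hD _
  calc _ = ‖∫ wp, ((n : ℝ) + 1)⁻¹ * fderiv ℝ g (skelFlowMapAt ω₂ lam β γ N T_L T_R s m z
        (pairRem m wp) (pairSkel m wp)) (ofCoordV N (skelCtrlDep ω₂ lam β γ N T_L T_R s m
          ((n : ℝ) + 1)⁻¹ b z (pairRem m wp) (pairSkel m wp))) ∂wienerPair‖ :=
        (Real.norm_eq_abs _).symm
    _ ≤ _ := norm_integral_le_lintegral_norm _
    _ ≤ (ENNReal.ofReal L * ENNReal.ofReal η).toReal :=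
        ENNReal.toReal_mono (ENNReal.mul_ne_top ENNReal.ofReal_ne_top ENNReal.ofReal_ne_top) hint
    _ = L * η := by rw [ENNReal.toReal_mul, ENNReal.toReal_ofReal hL, ENNReal.toReal_ofReal hη]

include hω hl hβ hγ hN hT hTL hTL' hTR hTR' in
/-- `∂_{p_b}(g ∘ E_m(·, B))(z)` is integrable along the path (`|·| ≤ L‖∂_zE[(0,e_b)]‖`, (JMᶻ)).
[folklore] -/
theorem integrable_partialP_dep_path {s : ℝ} (hs : s ∈ Icc (0 : ℝ) 1) (m : ℕ) (b : Fin N)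
    (z : PhaseSpace N) {g : PhaseSpace N → ℝ} (hg : ContDiff ℝ 1 g) {L : ℝ}
    (hgL : ∀ w v, |fderiv ℝ g w v| ≤ L * ‖v‖) :
    Integrable (fun wp : WienerPair => partialP b
      (fun z' => g (skelFlowMapAt ω₂ lam β γ N T_L T_R s m z' (pairRem m wp) (pairSkel m wp))) z)
      wienerPair := by
  have hfun : (fun wp : WienerPair => partialP b
      (fun z' => g (skelFlowMapAt ω₂ lam β γ N T_L T_R s m z' (pairRem m wp) (pairSkel m wp))) z) =
      fun wp => fderiv ℝ g (skelFlowMapAt ω₂ lam β γ N T_L T_R s m z (pairRem m wp) (pairSkel m wp))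
        (fderiv ℝ (fun z' => skelFlowMapAt ω₂ lam β γ N T_L T_R s m z' (pairRem m wp)
          (pairSkel m wp)) z ((0 : Fin N → ℝ), Pi.single b 1)) :=
    funext fun wp => partialP_comp_skelFlowMapAt_eq hω hl.le hβ.le hγ.le N T_L T_R hs m b z
      (pairRem m wp) (pairSkel m wp) hg
  rw [hfun]
  have hcont : Continuous fun p : PhaseSpace N × PhaseSpace N => fderiv ℝ g p.1 p.2 :=
    ((hg.continuous_fderiv one_ne_zero).comp continuous_fst).clm_apply continuous_snd
  have hE : Measurable fun wp : WienerPair =>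
      skelFlowMapAt ω₂ lam β γ N T_L T_R s m z (pairRem m wp) (pairSkel m wp) := by
    have h := (measurable_skelFlowMapAt hω hl.le hβ.le hγ.le N T_L T_R s m z).comp
      (measurable_pairSkel_prodMk_pairRem m)
    exact h
  have hJ := measurable_fderiv_left_path hω hl hβ hγ (T_L := T_L) (T_R := T_R) hs m z
    ((0 : Fin N → ℝ), Pi.single b 1)
  have hZ1 := integrable_pow_norm_fderiv_left_path hω hl hβ hγ hN hT hTL hTL' hTR hTR' hs m z
    ((0 : Fin N → ℝ), Pi.single b 1) 1 le_rfl
  refine Integrable.mono' (hZ1.const_mul L) (hcont.measurable.comp (hE.prodMk hJ)).aestronglyMeasurable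
    (Eventually.of_forall fun wp => ?_)
  rw [Real.norm_eq_abs, pow_one]
  exact hgL _ _

end Departure

end Summit.AtomisticToContinuum.FouriersLaw.Theorems.ExtensiveSnapshotIrreversibility.EnergyWindow

end
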